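import Summits.FinalStateConjecture.FinalStateConjecture.Theorems.PhotonSphereChannelsWindowedShellChannelsStubFarHalfShare

/-!
# Crux `WindowedShellChannels` (stmt-FinalStateConjecture-14085), line `Sketch` — stub `stub_farPolyShare`
# (the explicit-threshold far share, parity-free, two-sided)

There is ONE absolute constant `A > 0` (here `A = 2·10⁸`) such that for every mode `(s, ℓ)`,
`s ≤ 2`, `s ≤ ℓ`, of the unit-mass Regge–Wheeler equation along the centred tortoise line every
finite-energy global `C²` solution whose Cauchy data are supported in `(A(ℓ+1)⁴, ∞)` radiates at
least `E/64` ahead of the two apex-`0` far cones `{x > |t|}` in the two time directions together: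

  `E/64 ≤ farChannelEnergy V 0 ψ atTop + farChannelEnergy V 0 ψ atBot`.

Proof.  The two-sided far estimate for compactly supported far data of seat 0
(`FarHalfShareModel.stub_farHalfShare_compact`, threshold existential) is re-derived with its
threshold made explicit (`farHalfShare_compact_explicit`): inside that proof the threshold is
`max (max 9 (4D²)) (max (2·max 9 (4D²)) (4096 D²))`, `D = 200(ℓ+1)²`, for `ℓ ≥ 1`
(`= 163 840 000 (ℓ+1)⁴`) and `4096·54 + 108` for `ℓ = 0`, both `≤ 2·10⁸ (ℓ+1)⁴`.  Then the landed
density step `FarHalfShareModel.far_twoSided` removes the compact support, and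
`farChannelEnergy V 0 ψ l = liminf_l ∫⁻_{x > 0 + |t|} e[ψ](t)` is the `liminf` appearing there.
No parity, no definitions. [folklore in method; new]
-/

noncomputable section

set_option linter.dupNamespace false

namespace Summit.FinalStateConjecture.FinalStateConjecture.Theorems.WindowedShellChannelsSketch

open Literature.Geometry.Lorentzian Literature.Geometry.Lorentzian.ReggeWheeler Filter Set MeasureTheory
open Literature.Analysis.PDE Literature.Analysis.ODE Literature.Analysis.Calculus Real intervalIntegral
open scoped ENNReal Topology

namespace FarPolyShare

open FarHalfShareModel

/-- Threshold bookkeeping for `ℓ ≥ 1`: with `D = 200(ℓ+1)²`, `2·10⁸ (ℓ+1)⁴ ≤ R₀` gives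
`max 9 (4D²) ≤ R₀`, `2·max 9 (4D²) ≤ R₀` and `4096 D² ≤ R₀`. [folklore] -/
theorem thresholds_of_poly {ℓ : ℕ} {R₀ : ℝ} (hR₀ : 200000000 * ((ℓ : ℝ) + 1) ^ 4 ≤ R₀) :
    max 9 (4 * (200 * ((ℓ : ℝ) + 1) ^ 2) ^ 2) ≤ R₀ ∧
      2 * max 9 (4 * (200 * ((ℓ : ℝ) + 1) ^ 2) ^ 2) ≤ R₀ ∧
      4096 * (200 * ((ℓ : ℝ) + 1) ^ 2) ^ 2 ≤ R₀ := by
  have hP : (1 : ℝ) ≤ ((ℓ : ℝ) + 1) ^ 4 := one_le_pow₀ (by simp)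
  have hD2 : (200 * ((ℓ : ℝ) + 1) ^ 2) ^ 2 = 40000 * ((ℓ : ℝ) + 1) ^ 4 := by ring
  rw [hD2]
  have hmax : max 9 (4 * (40000 * ((ℓ : ℝ) + 1) ^ 4)) ≤ R₀ / 2 :=
    max_le (by linarith) (by linarith)
  exact ⟨by linarith, by linarith, by linarith⟩

/-- **The two-sided far estimate for compactly supported far data (one mode), explicit threshold.**
This is `FarHalfShareModel.stub_farHalfShare_compact` with `R_c = 2·10⁸ (ℓ+1)⁴`: every global `C²`
solution of the mode `(s, ℓ)`, `s ≤ 2`, `s ≤ ℓ`, with Cauchy data supported in `(R₀, B)`,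
`2·10⁸ (ℓ+1)⁴ ≤ R₀ ≤ B`, satisfies `E/16 ≤ liminf_{+∞} ∫⁻_{x>|t|} e + liminf_{−∞} ∫⁻_{x>|t|} e`.
(Proof copied from seat 0's part 2, the existential threshold replaced by the hypothesis.)
[folklore in method; new] -/
theorem farHalfShare_compact_explicit (s ℓ : ℕ) (hs : s ≤ 2) (hsℓ : s ≤ ℓ) :
    ∀ R₀ B : ℝ, 200000000 * ((ℓ : ℝ) + 1) ^ 4 ≤ R₀ → R₀ ≤ B → ∀ ψ : ℝ → ℝ → ℝ,
      IsRWSolution 1 s ℓ (tortoiseRadius one_pos 0) ψ → CauchyDataSupportedOn ψ (Ioo R₀ B) →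
        ENNReal.ofReal (1 / 16) * totalEnergy (linePotential 1 s ℓ (tortoiseRadius one_pos 0)) ψ 0
          ≤ liminf (fun t => ∫⁻ x in Ioi |t|, ENNReal.ofReal
              (energyDensity (linePotential 1 s ℓ (tortoiseRadius one_pos 0)) ψ t x)) atTop
            + liminf (fun t => ∫⁻ x in Ioi |t|, ENNReal.ofReal
              (energyDensity (linePotential 1 s ℓ (tortoiseRadius one_pos 0)) ψ t x)) atBot := by
  -- adapted from `FarHalfShareModel.stub_farHalfShare_compact` (…StubFarHalfShareTwoSided.lean)
  have hr := isTortoiseRadius_tortoiseRadius one_pos (0 : ℝ)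
  have hVd : Differentiable ℝ (linePotential 1 s ℓ (tortoiseRadius one_pos 0)) :=
    RW.differentiable_linePotential hr s ℓ
  have hV0 : ∀ x, 0 ≤ linePotential 1 s ℓ (tortoiseRadius one_pos 0) x :=
    fun x => (RW.linePotential_pos hr hsℓ x).le
  rcases Nat.eq_zero_or_pos ℓ with hℓ0 | hℓ
  · -- `ℓ = 0`, hence `s = 0`: the free model
    have hs0 : s = 0 := by omega
    subst hℓ0; subst hs0
    intro R₀ B hR₀ hR₀B ψ hψ hsupp
    have hR₀' : (200000000 : ℝ) ≤ R₀ := by norm_num at hR₀; exact hR₀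
    have hC := hψ.1
    have hh : ContDiff ℝ 2 (ψ 0) := hC.comp (contDiff_const.prodMk contDiff_id)
    have hg : ContDiff ℝ 1 (fun x => deriv (fun τ => ψ τ x) 0) := contDiff_one_tslice_deriv hC 0
    obtain ⟨φ, hφC, hφsol, hd0, hd1, hmodel⟩ :=
      free_coneModelWave hh hg (R₁ := R₀) (B := B) (by linarith) hR₀B
    refine stub_farHalfShare_transfer (V₀ := fun _ => 0) hVd hV0 continuous_const (fun _ => le_rfl)
      (X := 1) (D := Real.sqrt 54) one_pos (by linarith) (Real.sqrt_nonneg _)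
      (by rw [Real.sq_sqrt (by norm_num)]; linarith) hR₀B ?_ ?_ hψ hsupp hφC ?_
      (fun x => ⟨hd0 x, hd1 x⟩) (energy_le_two_model_zero hψ (by linarith) hR₀B hsupp) ?_
    · intro x hx
      have hx0 : 0 < x := by linarith
      rw [Real.sq_sqrt (by norm_num), zero_sub, neg_sq, sq]
      exact mul_le_mul_of_nonneg_right (far_bound_zero hx0) (hV0 x)
    · intro x _
      show (1 - 1 / 2) * (0 : ℝ) ≤ _
      rw [mul_zero]; exact hV0 x
    · intro t x _
      rw [zero_mul, add_zero]
      exact hφsol t x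
    · simpa only [zero_mul, add_zero] using hmodel
  · -- `ℓ ≥ 1`: the inverse-square model
    obtain ⟨ι, hι, hιeq, -, I, hI, hI'⟩ := exists_smooth_inv_extension
    intro R₀ B hR₀ hR₀B ψ hψ hsupp
    obtain ⟨hX, h2X, hbig⟩ := thresholds_of_poly hR₀
    set A : ℝ := 200 * ((ℓ : ℝ) + 1) ^ 2 with hA
    have hC := hψ.1
    have hh : ContDiff ℝ 2 (ψ 0) := hC.comp (contDiff_const.prodMk contDiff_id)
    have hg : ContDiff ℝ 1 (fun x => deriv (fun τ => ψ τ x) 0) := contDiff_one_tslice_deriv hC 0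
    have hdat0 : ∀ x, x ∉ Ioo R₀ B → ψ 0 x = 0 ∧ deriv (fun τ => ψ τ x) 0 = 0 := hsupp
    obtain ⟨φ, hφC, hφsol, hd0, hd1, hmodel⟩ := inverseSquare_coneModelWave hι hιeq hI hI' hℓ hh hg
      (R₁ := R₀) (B := B) (by linarith [(le_max_left _ _).trans hX]) hR₀B
      (fun x hx => (hdat0 x fun h => by linarith [h.1]).1)
      (fun x hx => (hdat0 x fun h => by linarith [h.1]).2)
      (fun x hx => (hdat0 x fun h => by linarith [h.2]).1)
      (fun x hx => (hdat0 x fun h => by linarith [h.2]).2)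
    have hX0 : 0 < max 9 (4 * A ^ 2) := lt_of_lt_of_le (by norm_num) (le_max_left _ _)
    refine stub_farHalfShare_transfer (V₀ := fun x => (ℓ : ℝ) * (ℓ + 1) * ι x ^ 2) hVd hV0
      (continuous_const.mul (hι.continuous.pow 2)) (fun x => by positivity) hX0 h2X
      (D := A) (by positivity) hbig hR₀B ?_ ?_ hψ hsupp hφC hφsol (fun x => ⟨hd0 x, hd1 x⟩)
      (energy_le_two_model_pos hs hsℓ hℓ hι.continuous hιeq hψ hX hR₀B hsupp) hmodel
    · intro x hx
      have hx0 : 0 < x := hX0.trans_le hx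
      have hι2 : ι x ^ 2 = (x ^ 2)⁻¹ := by
        rw [hιeq x (by linarith [(le_max_left _ _).trans hx]), inv_pow]
      rw [hι2]
      exact (far_bounds_pos hs hℓ hx).2.2
    · intro x hx
      have hι2 : ι x ^ 2 = (x ^ 2)⁻¹ := by
        rw [hιeq x (by linarith [(le_max_left _ _).trans hx]), inv_pow]
      rw [hι2]
      exact (far_bounds_pos hs hℓ hx).1

/-- With edge `xe = 0` the far channel energy is the `liminf` of `∫⁻_{x > |t|} e[ψ](t)`. [folklore] -/
theorem farChannelEnergy_zero_eq (V : ℝ → ℝ) (ψ : ℝ → ℝ → ℝ) (l : Filter ℝ) :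
    farChannelEnergy V 0 ψ l
      = liminf (fun t => ∫⁻ x in Ioi |t|, ENNReal.ofReal (energyDensity V ψ t x)) l := by
  have h : farEnergy V 0 ψ = fun t => ∫⁻ x in Ioi |t|, ENNReal.ofReal (energyDensity V ψ t x) := by
    funext t
    simp only [farEnergy, zero_add, Set.Ioi_def]
  rw [farChannelEnergy, h]

end FarPolyShare

open FarHalfShareModel FarPolyShare in
/-- **Stub `stub_farPolyShare` (explicit-threshold far share, parity-free, two-sided).**  There is
`A > 0` (namely `A = 2·10⁸`) such that for every mode `s ≤ 2`, `s ≤ ℓ` every finite-energy unit-mass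
centred Regge–Wheeler solution whose Cauchy data are supported in `(A(ℓ+1)⁴, ∞)` radiates at least
`E/64` ahead of the two apex-`0` far cones together:
`E/64 ≤ farChannelEnergy V 0 ψ atTop + farChannelEnergy V 0 ψ atBot`.  (Seat 0's density step
`FarHalfShareModel.far_twoSided` fed with the explicit-threshold compact estimate
`FarPolyShare.farHalfShare_compact_explicit`.) [folklore in method; new] -/
theorem stub_farPolyShare : ∃ A : ℝ, 0 < A ∧ ∀ (s ℓ : ℕ), s ≤ 2 → s ≤ ℓ → ∀ ψ : ℝ → ℝ → ℝ,
    IsRWSolution 1 s ℓ (tortoiseRadius one_pos 0) ψ →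
    CauchyDataSupportedOn ψ (Ioi (A * ((ℓ : ℝ) + 1) ^ 4)) →
    totalEnergy (linePotential 1 s ℓ (tortoiseRadius one_pos 0)) ψ 0 ≠ ⊤ →
      ENNReal.ofReal (1 / 64) * totalEnergy (linePotential 1 s ℓ (tortoiseRadius one_pos 0)) ψ 0 ≤
        farChannelEnergy (linePotential 1 s ℓ (tortoiseRadius one_pos 0)) 0 ψ atTop
          + farChannelEnergy (linePotential 1 s ℓ (tortoiseRadius one_pos 0)) 0 ψ atBot := by
  refine ⟨200000000, by norm_num, fun s ℓ hs hsℓ ψ hψ hsupp hfin => ?_⟩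
  have hP : (1 : ℝ) ≤ ((ℓ : ℝ) + 1) ^ 4 := one_le_pow₀ (by simp)
  have hRc : (3 : ℝ) ≤ 200000000 * ((ℓ : ℝ) + 1) ^ 4 := by linarith
  rw [farChannelEnergy_zero_eq, farChannelEnergy_zero_eq]
  exact far_twoSided hsℓ hRc (farHalfShare_compact_explicit s ℓ hs hsℓ) hψ hsupp hfin

end Summit.FinalStateConjecture.FinalStateConjecture.Theorems.WindowedShellChannelsSketch

end
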